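import Summits.QuantumFields.YangMills.Theorems.BalabanLadderIRHeavyTwistWallTorusGreen
import HarnessLib

/-!
# Slice sums of a real function on `(ℤ/L)³` through the line `k_⊥ = 0` of its Fourier transform (heavy-twist wall, D4)

HELPER 4/6 for the crux `BalabanLadder.IR` (stmt-QuantumFields-19354), line `heavy-twist` RUNG 2 on even boxes (wall seat
`ym-ir-wall-p1`).  Companion of `BalabanLadderIRHeavyTwistWallTorusGreen`.  For a real function `G` on the torus `(ℤ/L)³` with
Fourier transform `Ĝ = torusFourier G` and slice sums `S(s) = Σ_{w ∈ (ℤ/L)²} G(s ∷ w)` (all PROVED, no definitions):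

* `torusChar_cons`, `sum_torusChar_cons`, `sum_eq_sum_sum_cons` — characters and sums split along `Fin.cons`;
* `sliceSum_eq` — `S(s) = L⁻¹ Σ_{a ∈ ℤ/L} Re(Ĝ(a ∷ 0) e^{2πi a s/L})` (only the line `k_⊥ = 0` survives);
* `im_torusFourier_eq_zero_of_even` — the transform of an even real function is real;
* `sliceSum_zero_le` — under the infrared bound `(1 − cos(2πa/L)) Re Ĝ(a ∷ 0) ≤ f` (`a ≠ 0`, `f ≥ 0`):
  `S(0) ≤ L⁻¹ Re Ĝ(0) + f L²/8`;
* `le_sliceSum` — if moreover `Re Ĝ ≥ 0` and `G` is even: `S(s) ≥ L⁻¹ Re Ĝ(0) − f L²/8` for EVERY `s`.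

In the wall these are applied to `G = ` Borgs–Seiler's Polyakov two-point function `polyakovCorrelation ρ β β` of the cold box
(`L₀ = ⌊L/4⌋`), whose infrared bound, positivity and diagonal bound are tree theorems.

HONEST FRAMING: lattice Fourier bookkeeping; nothing here proves `BalabanLadder.IR`, its seed, or the Yang–Mills mass gap (Clay).
References: J. Fröhlich, B. Simon, T. Spencer, Commun. Math. Phys. 50 (1976) 79 §3; C. Borgs, E. Seiler, Commun. Math. Phys. 91 (1983) 329.
-/

set_option autoImplicit false

noncomputable section

open Finset Real ZMod
open Literature.Probability.LatticeModels

namespace Summit.QuantumFields.YangMills.Cruxes.IR.HeavyTwistWall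

/-! ## Slice sums of a real function on `(ℤ/L)³` through the line `k_⊥ = 0` of its Fourier transform -/

section Slice

open scoped ComplexConjugate

variable {L : ℕ} [NeZero L]

/-- Splitting a character of `(ℤ/L)³` along `Fin.cons`: `χ_k(s ∷ w) = e^{2πi k₀ s/L} · χ_{tail k}(w)`. -/
theorem torusChar_cons (k : TorusSite 3 L) (s : ZMod L) (w : TorusSite 2 L) :
    torusChar k (Fin.cons s w : TorusSite 3 L) = stdAddChar (k 0 * s) * torusChar (Fin.tail k) w := by
  unfold torusChar
  rw [Fin.prod_univ_succ]
  simp only [Fin.cons_zero, Fin.cons_succ, Fin.tail]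

/-- Summing a character over a slice `{x₀ = s}`: `Σ_w χ_k(s ∷ w) = e^{2πi k₀ s/L} · L² · [tail k = 0]`. -/
theorem sum_torusChar_cons (k : TorusSite 3 L) (s : ZMod L) :
    ∑ w : TorusSite 2 L, torusChar k (Fin.cons s w : TorusSite 3 L) =
      stdAddChar (k 0 * s) * (if Fin.tail k = 0 then (L : ℂ) ^ 2 else 0) := by
  simp_rw [torusChar_cons, ← Finset.mul_sum, sum_torusChar_right]

/-- Sums over `(ℤ/L)³` split along `Fin.cons`. -/
theorem sum_eq_sum_sum_cons {M : Type*} [AddCommMonoid M] (F : TorusSite 3 L → M) :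
    ∑ k : TorusSite 3 L, F k = ∑ a : ZMod L, ∑ w : TorusSite 2 L, F (Fin.cons a w) := by
  rw [← Fintype.sum_prod_type' (f := fun (a : ZMod L) (w : TorusSite 2 L) => F (Fin.cons a w))]
  exact (Fintype.sum_equiv (Fin.consEquiv fun _ : Fin 3 => ZMod L) _ _ fun p => rfl).symm

/-- **Slice sums through the Fourier transform.**  For a real function `G` on `(ℤ/L)³` and `s ∈ ℤ/L`,
`Σ_{w ∈ (ℤ/L)²} G(s ∷ w) = L⁻¹ Σ_{a ∈ ℤ/L} Re(Ĝ(a ∷ 0) e^{2πi a s/L})` (Fourier inversion and orthogonality of the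
characters of the two transverse directions: only the line `k_⊥ = 0` survives). -/
theorem sliceSum_eq (G : TorusSite 3 L → ℝ) (s : ZMod L) :
    ∑ w : TorusSite 2 L, G (Fin.cons s w) =
      (L : ℝ)⁻¹ * ∑ a : ZMod L, (torusFourier (fun x => (G x : ℂ)) (Fin.cons a 0) * stdAddChar (a * s)).re := by
  set Ghat : TorusSite 3 L → ℂ := torusFourier fun x => (G x : ℂ) with hGhat
  have hG : ∀ z, G z = (torusFourierInv Ghat z).re := fun z => by
    rw [hGhat, torusFourier_inversion_holds (d := 3) (L := L) fun x => (G x : ℂ), Complex.ofReal_re]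
  have hL0 : (L : ℂ) ≠ 0 := Nat.cast_ne_zero.2 (NeZero.ne L)
  -- expand, swap the sums, and use the orthogonality of the transverse characters
  have hsum : ∑ w : TorusSite 2 L, torusFourierInv Ghat (Fin.cons s w) =
      ((L : ℂ))⁻¹ * ∑ a : ZMod L, Ghat (Fin.cons a 0) * stdAddChar (a * s) := by
    simp_rw [torusFourierInv_eq_sum_torusChar, ← Finset.mul_sum]
    rw [Finset.sum_comm]
    simp_rw [← Finset.mul_sum, sum_torusChar_cons]
    rw [sum_eq_sum_sum_cons]
    have hinner : ∀ a : ZMod L, ∑ w : TorusSite 2 L, Ghat (Fin.cons a w) *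
        (stdAddChar ((Fin.cons a w : TorusSite 3 L) 0 * s) * (if Fin.tail (Fin.cons a w : TorusSite 3 L) = 0 then
          (L : ℂ) ^ 2 else 0)) = Ghat (Fin.cons a 0) * stdAddChar (a * s) * (L : ℂ) ^ 2 := by
      intro a
      simp only [Fin.tail_cons, mul_ite, mul_zero]
      rw [Finset.sum_ite_eq' Finset.univ (0 : TorusSite 2 L)]
      simp only [Finset.mem_univ, if_true, Fin.cons_zero]
      ring
    simp_rw [hinner, ← Finset.sum_mul]
    field_simp
  calc ∑ w : TorusSite 2 L, G (Fin.cons s w) = ∑ w : TorusSite 2 L, (torusFourierInv Ghat (Fin.cons s w)).re :=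
        Finset.sum_congr rfl fun w _ => hG _
    _ = (∑ w : TorusSite 2 L, torusFourierInv Ghat (Fin.cons s w)).re := (Complex.re_sum _ _).symm
    _ = (L : ℝ)⁻¹ * ∑ a : ZMod L, (Ghat (Fin.cons a 0) * stdAddChar (a * s)).re := by
        have hc : ((L : ℂ))⁻¹ = (((L : ℝ)⁻¹ : ℝ) : ℂ) := by push_cast; ring
        rw [hsum, hc, Complex.re_ofReal_mul, Complex.re_sum]

/-- The Fourier transform of an EVEN real function is real. -/
theorem im_torusFourier_eq_zero_of_even {d : ℕ} (G : TorusSite d L → ℝ) (heven : ∀ x, G (-x) = G x)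
    (k : TorusSite d L) : (torusFourier (fun x => (G x : ℂ)) k).im = 0 := by
  have hconj : conj (torusFourier (fun x => (G x : ℂ)) k) = torusFourier (fun x => (G x : ℂ)) k := by
    rw [torusFourier_eq_sum_torusChar, map_sum]
    calc ∑ x, conj ((G x : ℂ) * conj (torusChar k x)) = ∑ x, (G (-x) : ℂ) * conj (torusChar k (-x)) := by
          refine Finset.sum_congr rfl fun x _ => ?_
          rw [map_mul, Complex.conj_conj, Complex.conj_ofReal, heven x, torusChar_neg_right, Complex.conj_conj]
      _ = ∑ x, (G x : ℂ) * conj (torusChar k x) :=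
          Fintype.sum_equiv (Equiv.neg _) _ _ fun x => rfl
  exact Complex.conj_eq_iff_im.1 hconj

omit [NeZero L] in
/-- `a ∷ 0 = 0 ↔ a = 0` in `(ℤ/L)³`. -/
theorem cons_zero_eq_zero_iff (a : ZMod L) : (Fin.cons a (0 : TorusSite 2 L) : TorusSite 3 L) = 0 ↔ a = 0 := by
  constructor
  · intro h
    have := congrFun h 0
    simpa using this
  · rintro rfl
    funext i
    refine Fin.cases ?_ (fun j => ?_) i
    · simp
    · simp

/-- **Upper bound for the diagonal slice sum.**  If the infrared bound in direction `0` holds on the line `k_⊥ = 0`,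
`(1 − cos(2πa/L)) Re Ĝ(a ∷ 0) ≤ f` for `a ≠ 0` (`f ≥ 0`), then `Σ_w G(0 ∷ w) ≤ L⁻¹ Re Ĝ(0) + f L²/8`. -/
theorem sliceSum_zero_le (G : TorusSite 3 L → ℝ) {f : ℝ} (hf : 0 ≤ f)
    (hIR : ∀ a : ZMod L, a ≠ 0 →
      (1 - Real.cos (2 * Real.pi * (a.val : ℝ) / L)) * (torusFourier (fun x => (G x : ℂ)) (Fin.cons a 0)).re ≤ f) :
    ∑ w : TorusSite 2 L, G (Fin.cons 0 w) ≤
      (L : ℝ)⁻¹ * (torusFourier (fun x => (G x : ℂ)) 0).re + f * (L : ℝ) ^ 2 / 8 := by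
  classical
  have hL : (0 : ℝ) < L := Nat.cast_pos.2 (Nat.pos_of_ne_zero (NeZero.ne L))
  rw [sliceSum_eq]
  simp only [mul_zero, AddChar.map_zero_eq_one, mul_one]
  rw [← Finset.add_sum_erase _ _ (Finset.mem_univ (0 : ZMod L))]
  have h00 : (Fin.cons (0 : ZMod L) (0 : TorusSite 2 L) : TorusSite 3 L) = 0 := (cons_zero_eq_zero_iff 0).2 rfl
  rw [h00]
  -- the nonzero modes on the line
  have hterm : ∀ a ∈ (univ : Finset (ZMod L)).erase 0, (torusFourier (fun x => (G x : ℂ)) (Fin.cons a 0)).re ≤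
      f * (1 / (1 - Real.cos (2 * Real.pi * (a.val : ℝ) / L))) := by
    intro a ha
    have ha0 : a ≠ 0 := Finset.ne_of_mem_erase ha
    have hd := dispersion_latticeMomentum_ge (d := 1) (M := L) (fun _ => a)
    simp only [dispersion, latticeMomentum, Finset.univ_unique, Finset.sum_singleton] at hd
    have hv : (1 : ℝ) ≤ (((a.valMinAbs : ℤ) : ℝ) ^ 2) := by
      have h := one_le_sum_valMinAbs_sq (d := 1) (M := L) (p := fun _ => a) (fun h => ha0 (congrFun h 0))
      simpa using h
    have hcpos : 0 < 1 - Real.cos (2 * Real.pi * (a.val : ℝ) / L) := lt_of_lt_of_le (by positivity) hd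
    have h := hIR a ha0
    rw [mul_comm] at h
    rw [mul_one_div, le_div_iff₀ hcpos]
    exact h
  have hsum : ∑ a ∈ (univ : Finset (ZMod L)).erase 0, (torusFourier (fun x => (G x : ℂ)) (Fin.cons a 0)).re ≤
      f * ((L : ℝ) ^ 3 / 8) :=
    calc ∑ a ∈ (univ : Finset (ZMod L)).erase 0, (torusFourier (fun x => (G x : ℂ)) (Fin.cons a 0)).re
        ≤ ∑ a ∈ (univ : Finset (ZMod L)).erase 0, f * (1 / (1 - Real.cos (2 * Real.pi * (a.val : ℝ) / L))) :=
          Finset.sum_le_sum hterm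
      _ = f * ∑ a ∈ (univ : Finset (ZMod L)).erase 0, 1 / (1 - Real.cos (2 * Real.pi * (a.val : ℝ) / L)) := by
          rw [Finset.mul_sum]
      _ ≤ f * ((L : ℝ) ^ 3 / 8) := mul_le_mul_of_nonneg_left sum_inv_one_sub_cos_le hf
  rw [mul_add]
  have hLinv : (0 : ℝ) < (L : ℝ)⁻¹ := by positivity
  calc (L : ℝ)⁻¹ * (torusFourier (fun x => (G x : ℂ)) 0).re +
        (L : ℝ)⁻¹ * ∑ a ∈ (univ : Finset (ZMod L)).erase 0, (torusFourier (fun x => (G x : ℂ)) (Fin.cons a 0)).re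
      ≤ (L : ℝ)⁻¹ * (torusFourier (fun x => (G x : ℂ)) 0).re + (L : ℝ)⁻¹ * (f * ((L : ℝ) ^ 3 / 8)) := by
        gcongr
    _ = (L : ℝ)⁻¹ * (torusFourier (fun x => (G x : ℂ)) 0).re + f * (L : ℝ) ^ 2 / 8 := by
        field_simp

/-- **Lower bound for every slice sum.**  If `Re Ĝ ≥ 0`, `G` is even (so `Ĝ` is real) and the infrared bound in direction `0`
holds on the line `k_⊥ = 0` (`f ≥ 0`), then `Σ_w G(s ∷ w) ≥ L⁻¹ Re Ĝ(0) − f L²/8` for EVERY `s`. -/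
theorem le_sliceSum (G : TorusSite 3 L → ℝ) {f : ℝ} (hf : 0 ≤ f)
    (hpos : ∀ k, 0 ≤ (torusFourier (fun x => (G x : ℂ)) k).re) (heven : ∀ x, G (-x) = G x)
    (hIR : ∀ a : ZMod L, a ≠ 0 →
      (1 - Real.cos (2 * Real.pi * (a.val : ℝ) / L)) * (torusFourier (fun x => (G x : ℂ)) (Fin.cons a 0)).re ≤ f)
    (s : ZMod L) :
    (L : ℝ)⁻¹ * (torusFourier (fun x => (G x : ℂ)) 0).re - f * (L : ℝ) ^ 2 / 8 ≤ ∑ w : TorusSite 2 L, G (Fin.cons s w) := by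
  classical
  have hL : (0 : ℝ) < L := Nat.cast_pos.2 (Nat.pos_of_ne_zero (NeZero.ne L))
  rw [sliceSum_eq, ← Finset.add_sum_erase _ _ (Finset.mem_univ (0 : ZMod L))]
  have h00 : (Fin.cons (0 : ZMod L) (0 : TorusSite 2 L) : TorusSite 3 L) = 0 := (cons_zero_eq_zero_iff 0).2 rfl
  simp only [zero_mul, AddChar.map_zero_eq_one, mul_one]
  rw [h00]
  -- each nonzero mode contributes at least `−Re Ĝ(a ∷ 0)` (`Ĝ` real and non-negative, `|e^{iθ}| = 1`)
  have hterm : ∀ a ∈ (univ : Finset (ZMod L)).erase 0,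
      -(f * (1 / (1 - Real.cos (2 * Real.pi * (a.val : ℝ) / L)))) ≤
        (torusFourier (fun x => (G x : ℂ)) (Fin.cons a 0) * stdAddChar (a * s)).re := by
    intro a ha
    have ha0 : a ≠ 0 := Finset.ne_of_mem_erase ha
    have hd := dispersion_latticeMomentum_ge (d := 1) (M := L) (fun _ => a)
    simp only [dispersion, latticeMomentum, Finset.univ_unique, Finset.sum_singleton] at hd
    have hv : (1 : ℝ) ≤ (((a.valMinAbs : ℤ) : ℝ) ^ 2) := by
      have h := one_le_sum_valMinAbs_sq (d := 1) (M := L) (p := fun _ => a) (fun h => ha0 (congrFun h 0))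
      simpa using h
    have hcpos : 0 < 1 - Real.cos (2 * Real.pi * (a.val : ℝ) / L) := lt_of_lt_of_le (by positivity) hd
    have hre : (torusFourier (fun x => (G x : ℂ)) (Fin.cons a 0)).re ≤
        f * (1 / (1 - Real.cos (2 * Real.pi * (a.val : ℝ) / L))) := by
      have h := hIR a ha0
      rw [mul_comm] at h
      rw [mul_one_div, le_div_iff₀ hcpos]
      exact h
    -- `Re(Ĝ χ) ≥ −‖Ĝ‖ ‖χ‖ = −Re Ĝ`
    set z : ℂ := torusFourier (fun x => (G x : ℂ)) (Fin.cons a 0) with hz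
    have hzreal : z.im = 0 := im_torusFourier_eq_zero_of_even G heven _
    have hznn : 0 ≤ z.re := hpos _
    have hnormz : ‖z‖ = z.re := by
      rw [← Complex.re_add_im z, hzreal]
      simp [abs_of_nonneg hznn]
    have hchar : ‖(stdAddChar (a * s) : ℂ)‖ = 1 := AddChar.norm_apply _ _
    have h1 : |(z * stdAddChar (a * s)).re| ≤ z.re := by
      calc |(z * stdAddChar (a * s)).re| ≤ ‖z * stdAddChar (a * s)‖ := Complex.abs_re_le_norm _
        _ = z.re := by rw [norm_mul, hchar, mul_one, hnormz]
    have h2 := neg_le_of_abs_le h1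
    linarith
  have hsum : -(f * ((L : ℝ) ^ 3 / 8)) ≤
      ∑ a ∈ (univ : Finset (ZMod L)).erase 0, (torusFourier (fun x => (G x : ℂ)) (Fin.cons a 0) * stdAddChar (a * s)).re :=
    calc -(f * ((L : ℝ) ^ 3 / 8)) ≤ -(f * ∑ a ∈ (univ : Finset (ZMod L)).erase 0,
          1 / (1 - Real.cos (2 * Real.pi * (a.val : ℝ) / L))) := by
          have := mul_le_mul_of_nonneg_left (sum_inv_one_sub_cos_le (L := L)) hf
          linarith
      _ = ∑ a ∈ (univ : Finset (ZMod L)).erase 0, -(f * (1 / (1 - Real.cos (2 * Real.pi * (a.val : ℝ) / L)))) := by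
          rw [Finset.mul_sum, Finset.sum_neg_distrib]
      _ ≤ _ := Finset.sum_le_sum hterm
  rw [mul_add]
  have hLinv : (0 : ℝ) < (L : ℝ)⁻¹ := by positivity
  have hkey : (L : ℝ)⁻¹ * (-(f * ((L : ℝ) ^ 3 / 8))) ≤ (L : ℝ)⁻¹ *
      ∑ a ∈ (univ : Finset (ZMod L)).erase 0, (torusFourier (fun x => (G x : ℂ)) (Fin.cons a 0) * stdAddChar (a * s)).re :=
    mul_le_mul_of_nonneg_left hsum hLinv.le
  have he : (L : ℝ)⁻¹ * (-(f * ((L : ℝ) ^ 3 / 8))) = -(f * (L : ℝ) ^ 2 / 8) := by field_simp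
  rw [he] at hkey
  linarith

end Slice

end Summit.QuantumFields.YangMills.Cruxes.IR.HeavyTwistWall

end
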